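import Summits.Ventures.YMGap.Conjectures.TwistCensusParity
import Summits.Ventures.YMGap.Census.TwistCensusDegree
import Summits.Ventures.YMGap.Census.TwistCensusGermLaw
import Summits.Ventures.YMGap.Census.TwistCensusCosheets
import Summits.Ventures.YMGap.Census.TwistCensusTopMomentRP
import Summits.Ventures.YMGap.Census.TwistCensusTopMomentRectRP
import Summits.Ventures.YMGap.Census.TwistCensusTopMomentRectRPAxis
import HarnessLib

/-!
# Venture YMGap — Conjectures/TwistCensusParityReductions.lean: what is PROVED of the typed census conjecture and what
# exactly remains — `TwistCensusParity` ⟺ two Haar-moment statements per plane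

HONEST FRAMING (venture `Summits/Ventures/YMGap`, cell `pub-ymgap`, track (b)).  Theorems only; the conjecture
`TwistCensusParity` (file `Conjectures/TwistCensusParity.lean`) is NOT proved or refuted here and keeps its status
(EMPIRICAL LAW, item (16)).  This file records, for the 3-torus `L₀ × L₁ × L₂`, plane `(i, j)` with third axis `ρ`
(`P := L_iL_j`, `n := |𝒱_{ij}| = L_ρ` by `card_rectVortexSheet_three`, `|Λ₂| = 3L₀L₁L₂`):
* (G), first conjunct — `coeff_k N_{ij} = 0` for `k + 1 < P` — is a THEOREM (`Census.twistCensusPoly_coeff_eq_zero_of_lt`);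
  `germLaw_iff`: **(G) ⟺ `sheetMomentSum = L_ρ`** (`Census.twistCensusPoly_coeff_germ`);
* (D), the bound `deg N_{ij} ≤ 2|Λ₂| − 1 − P`, is a THEOREM (`Census.natDegree_twistCensusPoly_le_degreeLaw`);
  `degreeLaw_and_leadingSignLaw_iff`: **(D) ∧ (S∞) ⟺ `0 < cosheetMomentSum · I(Λ₂)`**
  (`Census.twistCensusPoly_coeff_degreeLaw`);
* (P) ⇐ (G) ∧ (S∞) (`parityLaw_of_germLaw_of_leadingSignLaw`, in the conjecture file);
* hence `twistCensusParity_iff_moments`: **`TwistCensusParity` ⟺ for every 3-torus with sides ≥ 2 and every plane,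
  `sheetMomentSum = L_ρ` and `0 < cosheetMomentSum · I(Λ₂)`** — mechanism N-3 of HOME/STRUCTURE.md §4 in exact form:
  what is conjectural is (a) that the plaquette sets of size `P` meeting the stack oddly and carrying a non-zero Haar
  moment are the `L_ρ` flat sheets with `2^P I(sheet) = 1`, and (b) the positivity of the top moments `I(Λ₂)`,
  `I(Λ₂ ∖ sheet)`.  Nothing about locations, limits or physics.
References: HOME/STRUCTURE.md §2 C-1, §4 N-3; E. T. Tomboulis, arXiv:0707.2179 §6 (6.2)–(6.4)
[cite: Tomboulis2007Confinement, §6 eqs. (6.2)–(6.4)].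
-/

noncomputable section

namespace Summit.Ventures.YMGap.Conjectures

open Polynomial Finset Summit.Ventures.YMGap.Census
open Literature.MathematicalPhysics.QuantumLattice (RectTorusSite)

variable (Ls : Fin 3 → ℕ) [∀ i, NeZero (Ls i)]

/-- The three axes of `Fin 3`: given `i < j` and `ρ ∉ {i, j}`, every axis is one of `i, j, ρ`. -/
private theorem fin3_cases : ∀ (i j ρ : Fin 3), i < j → ρ ≠ i → ρ ≠ j → ∀ k : Fin 3, k = i ∨ k = j ∨ k = ρ := by
  decide

/-- **In `d = 3` the twist stack `𝒱_{ij}` has `L_ρ` plaquettes** (`ρ` the third axis): `p ↦ x_ρ(p)` is a bijection onto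
`ℤ/L_ρ`. -/
theorem card_rectVortexSheet_three (i j ρ : Fin 3) (hij : i < j) (hρi : ρ ≠ i) (hρj : ρ ≠ j) :
    (rectVortexSheet Ls i j hij).card = Ls ρ := by
  have hk := fin3_cases i j ρ hij hρi hρj
  rw [← ZMod.card (Ls ρ), ← Finset.card_univ]
  refine Finset.card_bij (fun p _ => p.1 ρ) (fun p _ => Finset.mem_univ _) ?_ ?_
  · intro p hp q hq h
    rw [rectVortexSheet, Finset.mem_filter] at hp hq
    refine Prod.ext ?_ (hp.2.1.trans hq.2.1.symm)
    funext k
    rcases hk k with rfl | rfl | rfl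
    · rw [hp.2.2.1, hq.2.2.1]
    · rw [hp.2.2.2, hq.2.2.2]
    · exact h
  · intro t _
    refine ⟨((Pi.single ρ t : RectTorusSite Ls), ⟨(i, j), hij⟩), ?_, ?_⟩
    · rw [rectVortexSheet, Finset.mem_filter]
      exact ⟨Finset.mem_univ _, rfl, Pi.single_eq_of_ne (Ne.symm hρi) _, Pi.single_eq_of_ne (Ne.symm hρj) _⟩
    · simp

/-- In `d = 3`, `L_iL_j < |Λ₂|`: there are `3·|sites| ≥ 3·L_iL_j` plaquettes. -/
theorem mul_lt_card_rectPlaquette_three (i j : Fin 3) (hij : i < j) :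
    Ls i * Ls j < Fintype.card (RectPlaquette Ls) := by
  have h3 : Fintype.card {p : Fin 3 × Fin 3 // p.1 < p.2} = 3 := by decide
  have hf : Function.Injective fun c : ZMod (Ls i) × ZMod (Ls j) =>
      (Pi.single i c.1 + Pi.single j c.2 : RectTorusSite Ls) := by
    intro c c' hcc
    have h1 := congrArg (fun x : RectTorusSite Ls => x i) hcc
    have h2 := congrArg (fun x : RectTorusSite Ls => x j) hcc
    simp only [Pi.add_apply, Pi.single_eq_same, Pi.single_eq_of_ne hij.ne, Pi.single_eq_of_ne hij.ne',
      add_zero, zero_add] at h1 h2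
    exact Prod.ext h1 h2
  have hsites := Fintype.card_le_of_injective _ hf
  rw [Fintype.card_prod, ZMod.card, ZMod.card] at hsites
  have hP : 0 < Ls i * Ls j := Nat.pos_of_ne_zero (mul_ne_zero (NeZero.ne _) (NeZero.ne _))
  have hcard : Fintype.card (RectPlaquette Ls) = Fintype.card (RectTorusSite Ls) * 3 := by
    show Fintype.card (RectTorusSite Ls × {p : Fin 3 × Fin 3 // p.1 < p.2}) = _
    rw [Fintype.card_prod, h3]
  rw [hcard]
  omega

variable (i j ρ : Fin 3) (hij : i < j)

/-- **(G) ⟺ one Haar-moment identity.**  The first conjunct of the germ law is a theorem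
(`twistCensusPoly_coeff_eq_zero_of_lt`); the second says `−2·P·sheetMomentSum = −2·P·L_ρ`. -/
theorem germLaw_iff : GermLaw Ls i j ρ hij ↔ sheetMomentSum Ls hij = Ls ρ := by
  have hP : (0 : ℝ) < ((Ls i * Ls j : ℕ) : ℝ) := by
    have : 0 < Ls i * Ls j := Nat.pos_of_ne_zero (mul_ne_zero (NeZero.ne _) (NeZero.ne _))
    exact_mod_cast this
  unfold GermLaw
  rw [twistCensusPoly_coeff_germ]
  constructor
  · rintro ⟨_, h⟩
    have h' : ((Ls i * Ls j : ℕ) : ℝ) * (sheetMomentSum Ls hij - Ls ρ) = 0 := by linarith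
    rcases mul_eq_zero.mp h' with h1 | h1
    · exact absurd h1 hP.ne'
    · linarith
  · intro h
    refine ⟨fun k hk => twistCensusPoly_coeff_eq_zero_of_lt Ls hij hk, ?_⟩
    rw [h]
    ring

variable {i j ρ} in
/-- **(D) ∧ (S∞) ⟺ one Haar-moment positivity**: given the proved bound `deg N ≤ 2|Λ₂| − 1 − P` and the top-coefficient
formula, the degree is attained AND the leading sign is `(−1)^{L_ρ}` exactly when `cosheetMomentSum · I(Λ₂) > 0`. -/
theorem degreeLaw_and_leadingSignLaw_iff (hρi : ρ ≠ i) (hρj : ρ ≠ j) :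
    DegreeLaw Ls i j hij ∧ LeadingSignLaw Ls i j ρ hij ↔
      0 < cosheetMomentSum Ls hij * rectCharMoment Ls Finset.univ := by
  have hP : Ls i * Ls j < Fintype.card (RectPlaquette Ls) := mul_lt_card_rectPlaquette_three Ls i j hij
  have hcard : (rectVortexSheet Ls i j hij).card = Ls ρ := card_rectVortexSheet_three Ls i j ρ hij hρi hρj
  have hbound := natDegree_twistCensusPoly_le_degreeLaw Ls hij
  have htop := twistCensusPoly_coeff_degreeLaw Ls hij hP
  rw [hcard] at htop
  have hPpos : (0 : ℝ) < ((Ls i * Ls j : ℕ) : ℝ) := by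
    have : 0 < Ls i * Ls j := Nat.pos_of_ne_zero (mul_ne_zero (NeZero.ne _) (NeZero.ne _))
    exact_mod_cast this
  have h2pow : (0 : ℝ) < (2 : ℝ) ^ Fintype.card (RectPlaquette Ls) := by positivity
  have hsq : ((-1 : ℝ) ^ Ls ρ) * ((-1 : ℝ) ^ Ls ρ) = 1 := by rw [← mul_pow]; norm_num
  -- abbreviations
  set N := censusPoly Ls i j hij with hN
  set Dg := 2 * Fintype.card (RectPlaquette Ls) - 1 - Ls i * Ls j with hDg
  set X := cosheetMomentSum Ls hij * rectCharMoment Ls Finset.univ with hX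
  have htop' : N.coeff Dg = 2 * ((Ls i * Ls j : ℕ) : ℝ) * (2 : ℝ) ^ Fintype.card (RectPlaquette Ls) *
      (-1 : ℝ) ^ Ls ρ * X := by
    rw [hN, hDg, hX]
    change (twistCensusPoly Ls (rectVortexSheet Ls i j hij)).coeff _ = _
    rw [htop]
    ring
  constructor
  · rintro ⟨hD, hS⟩
    unfold LeadingSignLaw at hS
    unfold DegreeLaw at hD
    change 0 < (-1 : ℝ) ^ Ls ρ * N.leadingCoeff at hS
    change N.natDegree = Dg at hD
    have hlc : N.leadingCoeff = N.coeff Dg := by rw [leadingCoeff, hD]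
    rw [hlc, htop'] at hS
    have : (-1 : ℝ) ^ Ls ρ * (2 * ((Ls i * Ls j : ℕ) : ℝ) * (2 : ℝ) ^ Fintype.card (RectPlaquette Ls) *
        (-1 : ℝ) ^ Ls ρ * X) = (2 * ((Ls i * Ls j : ℕ) : ℝ) * (2 : ℝ) ^ Fintype.card (RectPlaquette Ls)) * X := by
      calc _ = ((-1 : ℝ) ^ Ls ρ * (-1 : ℝ) ^ Ls ρ) *
            (2 * ((Ls i * Ls j : ℕ) : ℝ) * (2 : ℝ) ^ Fintype.card (RectPlaquette Ls)) * X := by ring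
        _ = _ := by rw [hsq, one_mul]
    rw [this] at hS
    exact (pos_iff_pos_of_mul_pos hS).mp (by positivity)
  · intro hXpos
    have hA : (2 * ((Ls i * Ls j : ℕ) : ℝ) * (2 : ℝ) ^ Fintype.card (RectPlaquette Ls)) ≠ 0 := by positivity
    have hne : N.coeff Dg ≠ 0 := by
      rw [htop']
      exact mul_ne_zero (mul_ne_zero hA (pow_ne_zero _ (by norm_num))) hXpos.ne'
    have hdeg : N.natDegree = Dg := le_antisymm hbound (le_natDegree_of_ne_zero hne)
    refine ⟨hdeg, ?_⟩
    unfold LeadingSignLaw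
    rw [leadingCoeff]
    change 0 < (-1 : ℝ) ^ Ls ρ * N.coeff N.natDegree
    rw [hdeg, htop']
    have : (-1 : ℝ) ^ Ls ρ * (2 * ((Ls i * Ls j : ℕ) : ℝ) * (2 : ℝ) ^ Fintype.card (RectPlaquette Ls) *
        (-1 : ℝ) ^ Ls ρ * X) = (2 * ((Ls i * Ls j : ℕ) : ℝ) * (2 : ℝ) ^ Fintype.card (RectPlaquette Ls)) * X := by
      calc _ = ((-1 : ℝ) ^ Ls ρ * (-1 : ℝ) ^ Ls ρ) *
            (2 * ((Ls i * Ls j : ℕ) : ℝ) * (2 : ℝ) ^ Fintype.card (RectPlaquette Ls)) * X := by ring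
        _ = _ := by rw [hsq, one_mul]
    rw [this]
    exact mul_pos (by positivity) hXpos

/-- **The typed conjecture ⟺ two Haar-moment statements per plane** (everything else in (P)(G)(D)(S∞) is proved). -/
theorem twistCensusParity_iff_moments :
    TwistCensusParity ↔ ∀ (Ls : Fin 3 → ℕ) [∀ i, NeZero (Ls i)], (∀ k, 2 ≤ Ls k) →
      ∀ (i j ρ : Fin 3) (hij : i < j), ρ ≠ i → ρ ≠ j →
        sheetMomentSum Ls hij = Ls ρ ∧ 0 < cosheetMomentSum Ls hij * rectCharMoment Ls Finset.univ := by
  rw [twistCensusParity_iff_laws]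
  constructor
  · intro h Ls _ hL i j ρ hij hρi hρj
    obtain ⟨hG, hD, hS⟩ := h Ls hL i j ρ hij hρi hρj
    exact ⟨(germLaw_iff Ls i j ρ hij).mp hG, (degreeLaw_and_leadingSignLaw_iff Ls hij hρi hρj).mp ⟨hD, hS⟩⟩
  · intro h Ls _ hL i j ρ hij hρi hρj
    obtain ⟨h1, h2⟩ := h Ls hL i j ρ hij hρi hρj
    obtain ⟨hD, hS⟩ := (degreeLaw_and_leadingSignLaw_iff Ls hij hρi hρj).mpr h2
    exact ⟨(germLaw_iff Ls i j ρ hij).mpr h1, hD, hS⟩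

/-! ## Revision 2 (append-only): (G) is a THEOREM; the conjecture ⟺ ONE sign condition per plane

With lit-2 g12's `Census/TwistCensusSheets` / `TwistCensusSheetIntegral` / `TwistCensusGermLaw` (classification of the germ
supports as the `L_ρ` flat sheets + the sheet integral `2^{L_iL_j} I(sheet) = 1` ⇒ `germLaw_fin_three`) and
`Census/TwistCensusCosheets` (cosheet classification + translation invariance ⇒ `cosheetMomentSum_mul_pos_iff`):
(G) holds outright, (P) follows from (S∞) alone, and `TwistCensusParity` is EQUIVALENT to: for every 3-torus with sides
≥ 2 and every plane `(i, j)`, `0 < I(Λ₂ ∖ Π₀) · I(Λ₂)`, `Π₀ = flatSheet 0` the coordinate `(i, j)`-plane through the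
origin — the one-character Haar moments of all plaquettes, and of all plaquettes outside one coordinate plane, have the
same strict sign.  Neither sign is claimed; the conjecture keeps its status. -/

/-- Every plane of `Fin 3` has a third axis. -/
private theorem fin3_third : ∀ (i j : Fin 3), i < j → ∃ ρ : Fin 3, ρ ≠ i ∧ ρ ≠ j := by
  decide

/-- ★ **The germ law (G) is a theorem on every 3-torus** (engine-1's vanishing half + lit-2's sheet classification and
sheet integral, `Census.germLaw_fin_three`). -/
theorem germLaw (hρi : ρ ≠ i) (hρj : ρ ≠ j) : GermLaw Ls i j ρ hij :=
  germLaw_fin_three Ls i j ρ hij hρi hρj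

/-- Hence **(P) ⇐ (S∞)** alone. -/
theorem parityLaw_of_leadingSignLaw (hρi : ρ ≠ i) (hρj : ρ ≠ j) (hS : LeadingSignLaw Ls i j ρ hij) :
    ParityLaw Ls i j ρ hij :=
  parityLaw_of_germLaw_of_leadingSignLaw Ls i j ρ hij (germLaw Ls i j ρ hij hρi hρj) hS

variable {i j ρ} in
/-- **(D) ∧ (S∞) ⟺ the sign of one product**: `0 < I(Λ₂ ∖ Π₀) · I(Λ₂)`, `Π₀ = flatSheet 0` (lit-2's cosheet classification
+ translation invariance on top of `degreeLaw_and_leadingSignLaw_iff`). -/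
theorem degreeLaw_and_leadingSignLaw_iff_product (hρi : ρ ≠ i) (hρj : ρ ≠ j) :
    DegreeLaw Ls i j hij ∧ LeadingSignLaw Ls i j ρ hij ↔
      0 < rectCharMoment Ls (Finset.univ \ flatSheet Ls hij 0) * rectCharMoment Ls Finset.univ :=
  (degreeLaw_and_leadingSignLaw_iff Ls hij hρi hρj).trans (cosheetMomentSum_mul_pos_iff Ls hij 0)

/-- ★★ **The typed conjecture EQUALS one sign condition per plane**: `TwistCensusParity` holds iff for every 3-torus with
sides ≥ 2 and every plane `(i, j)`, `0 < I(Λ₂ ∖ Π₀) · I(Λ₂)`.  ((G) is a theorem; (P) follows from (S∞); (D) ∧ (S∞) ⟺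
this sign.) -/
theorem twistCensusParity_iff_product :
    TwistCensusParity ↔ ∀ (Ls : Fin 3 → ℕ) [∀ i, NeZero (Ls i)], (∀ k, 2 ≤ Ls k) →
      ∀ (i j : Fin 3) (hij : i < j),
        0 < rectCharMoment Ls (Finset.univ \ flatSheet Ls hij 0) * rectCharMoment Ls Finset.univ := by
  rw [twistCensusParity_iff_laws]
  constructor
  · intro h Ls _ hL i j hij
    obtain ⟨ρ, hρi, hρj⟩ := fin3_third i j hij
    obtain ⟨_, hD, hS⟩ := h Ls hL i j ρ hij hρi hρj
    exact (degreeLaw_and_leadingSignLaw_iff_product Ls hij hρi hρj).mp ⟨hD, hS⟩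
  · intro h Ls _ hL i j ρ hij hρi hρj
    obtain ⟨hD, hS⟩ := (degreeLaw_and_leadingSignLaw_iff_product Ls hij hρi hρj).mpr (h Ls hL i j hij)
    exact ⟨germLaw Ls i j ρ hij hρi hρj, hD, hS⟩


/-! ## Revision 3 (append-only): on the EVEN CUBES `(2k)³` the signs are forced — there C-1 ⟺ its degree law (D)

With engine-1 g9's `Census/TwistCensusTopMomentRP` (Osterwalder–Seiler reflection positivity, via the tree's
`FieldRP.coefFieldZ_nonneg`, applied to the indicator coefficient field of a mirror-symmetric plaquette set): on the cubic
torus `(ℤ/Lℤ)³` with `L` even, `0 ≤ I(Λ₂)` and `0 ≤ I(Λ₂ ∖ Π)` for every flat coordinate sheet `Π`, so the product whose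
STRICT sign is (D) ∧ (S∞) (`degreeLaw_and_leadingSignLaw_iff_product`) is `≥ 0` outright (`product_nonneg_cube`), and the
degree law ALONE gives the other three clauses (`laws_of_degreeLaw_cube`); the conjecture's conjunct for an even cube is
EQUIVALENT to its three degree laws (`cube_laws_iff_degreeLaw`).  Rectangular tori with an even side need the reflection
geometry on `RectTorusSite` (not in the tree); odd tori are out of reach of reflection positivity.  The conjecture keeps
its status; nothing about locations, limits or physics. -/

/-- **On an even cube the deciding product is `≥ 0` for every plane**: `0 ≤ I(Λ₂ ∖ Π₀) · I(Λ₂)` on `(2k)³`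
(`Census.rectCharMoment_compl_flatSheet_nonneg_of_even`, `Census.rectCharMoment_univ_nonneg_of_even`). -/
theorem product_nonneg_cube (L : ℕ) [NeZero L] (hL : Even L) (i j : Fin 3) (hij : i < j) :
    0 ≤ rectCharMoment (fun _ : Fin 3 => L) (Finset.univ \ flatSheet (fun _ : Fin 3 => L) hij 0) *
      rectCharMoment (fun _ : Fin 3 => L) Finset.univ :=
  mul_nonneg (rectCharMoment_compl_flatSheet_nonneg_of_even hL hij 0) (rectCharMoment_univ_nonneg_of_even hL)

/-- ★ **(D) ⇒ (P) ∧ (G) ∧ (D) ∧ (S∞) on the even cubes**: on `(2k)³`, for every plane `(i, j)` with third axis `ρ`, the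
degree law alone yields the full conjunct of `TwistCensusParity` for that plane ((G) is a theorem everywhere, `germLaw`;
(S∞) from (D) by `Census.leadingSignLaw_of_degreeLaw_cube`; (P) by `Census.parityLaw_of_degreeLaw_cube`). -/
theorem laws_of_degreeLaw_cube (L : ℕ) [NeZero L] (hL : Even L) (i j ρ : Fin 3) (hij : i < j) (hρi : ρ ≠ i)
    (hρj : ρ ≠ j) (hD : DegreeLaw (fun _ : Fin 3 => L) i j hij) :
    ParityLaw (fun _ : Fin 3 => L) i j ρ hij ∧ GermLaw (fun _ : Fin 3 => L) i j ρ hij ∧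
      DegreeLaw (fun _ : Fin 3 => L) i j hij ∧ LeadingSignLaw (fun _ : Fin 3 => L) i j ρ hij :=
  ⟨parityLaw_of_degreeLaw_cube hL hij ρ hD, germLaw (fun _ : Fin 3 => L) i j ρ hij hρi hρj, hD,
    leadingSignLaw_of_degreeLaw_cube hL hij ρ hD⟩

/-- ★★ **The conjunct of `TwistCensusParity` for an even cube `(2k)³` is EQUIVALENT to its degree laws**: reflection
positivity has removed every SIGN statement there; what remains is the non-vanishing `deg N_{ij} = 2|Λ₂| − 1 − L²`
(equivalently `I(Λ₂ ∖ Π₀) · I(Λ₂) ≠ 0`) for the three coordinate planes. -/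
theorem cube_laws_iff_degreeLaw (L : ℕ) [NeZero L] (hL : Even L) :
    (∀ (i j ρ : Fin 3) (hij : i < j), ρ ≠ i → ρ ≠ j →
        ParityLaw (fun _ : Fin 3 => L) i j ρ hij ∧ GermLaw (fun _ : Fin 3 => L) i j ρ hij ∧
          DegreeLaw (fun _ : Fin 3 => L) i j hij ∧ LeadingSignLaw (fun _ : Fin 3 => L) i j ρ hij) ↔
      ∀ (i j : Fin 3) (hij : i < j), DegreeLaw (fun _ : Fin 3 => L) i j hij := by
  constructor
  · intro h i j hij
    obtain ⟨ρ, hρi, hρj⟩ := fin3_third i j hij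
    exact (h i j ρ hij hρi hρj).2.2.1
  · intro h i j ρ hij hρi hρj
    exact laws_of_degreeLaw_cube L hL i j ρ hij hρi hρj (h i j hij)

/-- **(D) ⟺ the deciding product is non-zero, on the even cubes**: since the product is `≥ 0` there, the degree law of a
plane holds iff `I(Λ₂ ∖ Π₀) · I(Λ₂) ≠ 0`. -/
theorem degreeLaw_cube_iff_product_ne_zero (L : ℕ) [NeZero L] (hL : Even L) (i j ρ : Fin 3) (hij : i < j)
    (hρi : ρ ≠ i) (hρj : ρ ≠ j) :
    DegreeLaw (fun _ : Fin 3 => L) i j hij ↔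
      rectCharMoment (fun _ : Fin 3 => L) (Finset.univ \ flatSheet (fun _ : Fin 3 => L) hij 0) *
        rectCharMoment (fun _ : Fin 3 => L) Finset.univ ≠ 0 := by
  constructor
  · intro hD
    exact ((degreeLaw_and_leadingSignLaw_iff_product (fun _ : Fin 3 => L) hij hρi hρj).mp
      ⟨hD, leadingSignLaw_of_degreeLaw_cube hL hij ρ hD⟩).ne'
  · intro hne
    exact ((degreeLaw_and_leadingSignLaw_iff_product (fun _ : Fin 3 => L) hij hρi hρj).mpr
      (lt_of_le_of_ne (product_nonneg_cube L hL i j hij) (Ne.symm hne))).1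

/-! ## Revision 4 (append-only): RECTANGULAR tori with an even first side — for the planes through that axis, C-1 ⟺ (D)

With engine-1 g9's port of the Osterwalder–Seiler machinery to `RectTorusSite Ls` (`Census/RectReflectionGeometry`,
`RectReflectionMeasure`, `RectReflectionPositivity`, `TwistCensusTopMomentRectRP`): on every 3-torus `L₀ × L₁ × L₂` with `L₀` EVEN
and every plane `(0, j)` (third axis `ρ`), `0 ≤ I(Λ₂ ∖ Π₀) · I(Λ₂)` (`product_nonneg_of_even_side`), so the degree law (D) ALONE gives
(P), (G), (S∞) for that plane (`laws_of_degreeLaw_of_even_side`), and (D) ⟺ `I(Λ₂ ∖ Π₀) · I(Λ₂) ≠ 0`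
(`degreeLaw_iff_product_ne_zero_of_even_side`).  This covers the census families `2²×L`, `2×3×L`, `2×4×L`, `2×5×L`, `4²×L` as
written (even first side), planes containing the axis `0`; planes without an even axis and all-odd tori are untouched; the
conjecture keeps its status; nothing about locations, limits or physics. -/

/-- **On a 3-torus with an even first side the deciding product is `≥ 0` for the planes `(0, j)`.** -/
theorem product_nonneg_of_even_side (Ls : Fin 3 → ℕ) [∀ i, NeZero (Ls i)] (hL : Even (Ls 0)) (j : Fin 3)
    (h0j : (0 : Fin 3) < j) :
    0 ≤ rectCharMoment Ls (Finset.univ \ flatSheet Ls h0j 0) * rectCharMoment Ls Finset.univ :=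
  mul_nonneg (rectCharMoment_compl_flatSheet_nonneg_of_even_side Ls hL h0j 0) (rectCharMoment_univ_nonneg_of_even_side Ls hL)

/-- ★ **(D) ⇒ (P) ∧ (G) ∧ (D) ∧ (S∞) on a 3-torus with an even first side, planes `(0, j)`**: the degree law alone yields the
full conjunct of `TwistCensusParity` for that plane ((G) is a theorem everywhere; (S∞), (P) from (D) by
`Census.leadingSignLaw_of_degreeLaw_of_even_side`, `Census.parityLaw_of_degreeLaw_of_even_side`). -/
theorem laws_of_degreeLaw_of_even_side (Ls : Fin 3 → ℕ) [∀ i, NeZero (Ls i)] (hL : Even (Ls 0)) (j ρ : Fin 3)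
    (h0j : (0 : Fin 3) < j) (hρ0 : ρ ≠ 0) (hρj : ρ ≠ j) (hD : DegreeLaw Ls 0 j h0j) :
    ParityLaw Ls 0 j ρ h0j ∧ GermLaw Ls 0 j ρ h0j ∧ DegreeLaw Ls 0 j h0j ∧ LeadingSignLaw Ls 0 j ρ h0j :=
  ⟨parityLaw_of_degreeLaw_of_even_side Ls hL h0j ρ hρ0 hρj hD, germLaw Ls 0 j ρ h0j hρ0 hρj, hD,
    leadingSignLaw_of_degreeLaw_of_even_side Ls hL h0j ρ hρ0 hρj hD⟩

/-- **(D) ⟺ the deciding product is non-zero**, 3-torus with an even first side, planes `(0, j)`. -/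
theorem degreeLaw_iff_product_ne_zero_of_even_side (Ls : Fin 3 → ℕ) [∀ i, NeZero (Ls i)] (hL : Even (Ls 0)) (j ρ : Fin 3)
    (h0j : (0 : Fin 3) < j) (hρ0 : ρ ≠ 0) (hρj : ρ ≠ j) :
    DegreeLaw Ls 0 j h0j ↔ rectCharMoment Ls (Finset.univ \ flatSheet Ls h0j 0) * rectCharMoment Ls Finset.univ ≠ 0 := by
  constructor
  · intro hD
    exact ((degreeLaw_and_leadingSignLaw_iff_product Ls h0j hρ0 hρj).mp
      ⟨hD, leadingSignLaw_of_degreeLaw_of_even_side Ls hL h0j ρ hρ0 hρj hD⟩).ne'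
  · intro hne
    exact ((degreeLaw_and_leadingSignLaw_iff_product Ls h0j hρ0 hρj).mpr
      (lt_of_le_of_ne (product_nonneg_of_even_side Ls hL j h0j) (Ne.symm hne))).1

/-! ## Revision 5 (append-only): ANY even side — for every plane through an even axis, C-1 ⟺ (D); two even sides ⇒ all planes

With engine-1 g10's axis-transposition transport (`Census/RectAxisTranspose`: the census objects of `Ls` and of `Ls ∘ (0 a)` are
the same, Haar measure preserved) composed with Revision 4's first-axis sign rule (`Census/TwistCensusTopMomentRectRPAxis`): on
every 3-torus `L₀ × L₁ × L₂` and every plane `(i, j)` (third axis `ρ`) containing an axis `a` with `L_a` EVEN,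
`0 ≤ I(Λ₂ ∖ Π₀) · I(Λ₂)` (`product_nonneg_of_even_axis`), so (D) ALONE gives (P), (G), (S∞) for that plane
(`laws_of_degreeLaw_of_even_axis`) and (D) ⟺ `I(Λ₂ ∖ Π₀) · I(Λ₂) ≠ 0` (`degreeLaw_iff_product_ne_zero_of_even_axis`); on a 3-torus
with (at least) TWO even sides every plane contains an even axis, so the torus's full conjunct of `TwistCensusParity` is
EQUIVALENT to its three degree laws (`laws_iff_degreeLaw_of_two_even_sides`: `2²×L`, `2×4×L`, `4²×L`, … every `L`).  Left open
by reflection positivity: planes with both sides odd (one per torus with exactly one even side, e.g. `(1, 2)` of `2×3×5`), the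
all-odd tori, and (D) itself.  The conjecture keeps its status; nothing about locations, limits or physics. -/

/-- **The deciding product is `≥ 0` for every plane through an even axis** (`Π₀ = flatSheet 0`). -/
theorem product_nonneg_of_even_axis (Ls : Fin 3 → ℕ) [∀ i, NeZero (Ls i)] {i j : Fin 3} (hij : i < j) {a : Fin 3}
    (ha : a = i ∨ a = j) (hL : Even (Ls a)) :
    0 ≤ rectCharMoment Ls (Finset.univ \ flatSheet Ls hij 0) * rectCharMoment Ls Finset.univ :=
  rectCharMoment_compl_flatSheet_mul_univ_nonneg_of_even_axis Ls hij ha hL 0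

/-- ★ **(D) ⇒ (P) ∧ (G) ∧ (D) ∧ (S∞) for every plane through an even axis**: on a 3-torus, if the plane `(i, j)` (third axis
`ρ`) contains an axis `a` with `L_a` even, the degree law alone yields the full conjunct of `TwistCensusParity` for that plane
(`Census.parityLaw_of_degreeLaw_of_even_axis`, `Census.leadingSignLaw_of_degreeLaw_of_even_axis`; (G) is a theorem everywhere). -/
theorem laws_of_degreeLaw_of_even_axis (Ls : Fin 3 → ℕ) [∀ i, NeZero (Ls i)] {i j : Fin 3} (hij : i < j) (ρ : Fin 3)
    (hρi : ρ ≠ i) (hρj : ρ ≠ j) {a : Fin 3} (ha : a = i ∨ a = j) (hL : Even (Ls a)) (hD : DegreeLaw Ls i j hij) :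
    ParityLaw Ls i j ρ hij ∧ GermLaw Ls i j ρ hij ∧ DegreeLaw Ls i j hij ∧ LeadingSignLaw Ls i j ρ hij :=
  ⟨parityLaw_of_degreeLaw_of_even_axis Ls hij ρ hρi hρj ha hL hD, germLaw Ls i j ρ hij hρi hρj, hD,
    leadingSignLaw_of_degreeLaw_of_even_axis Ls hij ρ hρi hρj ha hL hD⟩

/-- **(D) ⟺ the deciding product is non-zero**, for every plane through an even axis. -/
theorem degreeLaw_iff_product_ne_zero_of_even_axis (Ls : Fin 3 → ℕ) [∀ i, NeZero (Ls i)] {i j : Fin 3} (hij : i < j)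
    (ρ : Fin 3) (hρi : ρ ≠ i) (hρj : ρ ≠ j) {a : Fin 3} (ha : a = i ∨ a = j) (hL : Even (Ls a)) :
    DegreeLaw Ls i j hij ↔ rectCharMoment Ls (Finset.univ \ flatSheet Ls hij 0) * rectCharMoment Ls Finset.univ ≠ 0 := by
  constructor
  · intro hD
    exact ((degreeLaw_and_leadingSignLaw_iff_product Ls hij hρi hρj).mp
      ⟨hD, leadingSignLaw_of_degreeLaw_of_even_axis Ls hij ρ hρi hρj ha hL hD⟩).ne'
  · intro hne
    exact ((degreeLaw_and_leadingSignLaw_iff_product Ls hij hρi hρj).mpr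
      (lt_of_le_of_ne (product_nonneg_of_even_axis Ls hij ha hL) (Ne.symm hne))).1

/-- The three axes of a 3-torus are a plane's two axes and its third axis (plumbing). -/
private theorem fin3_cover : ∀ (i j ρ x : Fin 3), i < j → ρ ≠ i → ρ ≠ j → x = i ∨ x = j ∨ x = ρ := by decide

/-- ★★ **Two even sides: the torus's conjunct of C-1 is EQUIVALENT to its three degree laws.**  On a 3-torus with two distinct
even sides `L_a`, `L_b`, every plane contains `a` or `b`, so (P) ∧ (G) ∧ (D) ∧ (S∞) for all planes ⟺ (D) for all planes. -/
theorem laws_iff_degreeLaw_of_two_even_sides (Ls : Fin 3 → ℕ) [∀ i, NeZero (Ls i)] {a b : Fin 3} (hab : a ≠ b)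
    (ha : Even (Ls a)) (hb : Even (Ls b)) :
    (∀ (i j ρ : Fin 3) (hij : i < j), ρ ≠ i → ρ ≠ j →
        ParityLaw Ls i j ρ hij ∧ GermLaw Ls i j ρ hij ∧ DegreeLaw Ls i j hij ∧ LeadingSignLaw Ls i j ρ hij) ↔
      ∀ (i j : Fin 3) (hij : i < j), DegreeLaw Ls i j hij := by
  constructor
  · intro h i j hij
    obtain ⟨ρ, hρi, hρj⟩ := fin3_third i j hij
    exact (h i j ρ hij hρi hρj).2.2.1
  · intro h i j ρ hij hρi hρj
    rcases fin3_cover i j ρ a hij hρi hρj with hai | haj | haρ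
    · exact laws_of_degreeLaw_of_even_axis Ls hij ρ hρi hρj (Or.inl hai) ha (h i j hij)
    · exact laws_of_degreeLaw_of_even_axis Ls hij ρ hρi hρj (Or.inr haj) ha (h i j hij)
    · rcases fin3_cover i j ρ b hij hρi hρj with hbi | hbj | hbρ
      · exact laws_of_degreeLaw_of_even_axis Ls hij ρ hρi hρj (Or.inl hbi) hb (h i j hij)
      · exact laws_of_degreeLaw_of_even_axis Ls hij ρ hρi hρj (Or.inr hbj) hb (h i j hij)
      · exact absurd (haρ.trans hbρ.symm) hab

end Summit.Ventures.YMGap.Conjectures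

end
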